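import Summits.QuantumFields.YangMills.Theorems.QuantileBitPurityGAxisField
import Summits.QuantumFields.YangMills.Theorems.QuantileBitPurityGAxisCost
import Summits.QuantumFields.YangMills.Theorems.ToronSmallBallOwnAxisShiftBasic
import HarnessLib

/-!
# The seam-axis sheet shift on the good-field event: the cost exponent, measurability, measure preservation

Support module (`--supports` stmt-QuantumFields-23948, `QuantileBitPurity.HolonomyQuantileSubQuartic`; seat ym-dw-p1 g16, plan HOME
`bc/g15-dw/PLAN-CORE-GAXIS.md`, modules M1 + C1 applied).  For the seam-axis sheet shift `gAxisShift θ χ₀ σ₁ g U⃗ = (siteTwist 0 (gAxisField θ χ₀ σ₁ g U⃗₀) U⃗_t)_t`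
(defs module `QuantileBitPurityGAxisDefs`) on the ring of `n+1` slices closed through the UNTWISTED seam `(U_n, g·U_0)`:

* §1 the environment on the tree's good-field event `TT.goodEvent n 0 s t` (all slice actions `< s`, interior bonds and the seam bond linkwise `t`-close):
  slices drift by at most `n t` from slice `0`, the seam field's gauge image of slice `0` is `(n+1)t`-close to it, the seam field almost commutes with
  the `y`- and `z`-holonomies through the origin (`≤ L(n+1)t`), which almost commute with each other (`≤ L²√s`);
* §2 ★ `seamDensity_le_exp_mul_gAxisShift`: on `goodEvent n 0 s t` the sector density satisfies `w₀(U⃗, g) ≤ exp(Q) · w₀(gAxisShift … g U⃗, g)` with the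
  EXPLICIT exponent `Q = β((n+1) · #P · (D² + 2D√s) + #E · (D_g² + 2D_g t))`,
  `D = |θ|(L(n+1)t/χ₀ + L²√s/σ₁ + 2σ₁) + 2L²√s|θ| + 2nt|θ|`, `D_g = 2χ₀|θ| + 4L(n+1)t|θ|` (modules `…GAxisField`, `…GAxisCost`);
* §3 measurability of `(g, U) ↦ gAxisField θ χ₀ σ₁ g U`, its independence from the sheet links, hence ★ `measurePreserving_gAxisShift`: for every seam
  field `g` the shift preserves `⊗_t Haar` (tree `measurePreserving_chain_siteTwist_of_indep`), and joint measurability of `(g, U⃗) ↦ gAxisShift … g U⃗`.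

HONEST FRAMING: fixed-lattice bookkeeping; nothing about infinite volume, the continuum limit or the Clay gap.  No `sorry`, no new axiom, no new
definition.  References: [cite: Luscher1983, §2]; [cite: SeilerLNP1982, §3]; [cite: tHooft1979].
-/

set_option autoImplicit false

noncomputable section

open scoped Quaternion BigOperators
open MeasureTheory NormedSpace Function
open Literature.MathematicalPhysics.QuantumLattice (su2Quat su2Quat_ne_zero norm_su2Quat secondCountableTopology_su2)
open Literature.MathematicalPhysics.QuantumFieldTheory hiding su2Quat_mul
open Literature.MathematicalPhysics.QuantumFieldTheory.Balaban1983to89.T4HaarSU2ExpChart (expPoint measurable_expPoint)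
open Literature.MathematicalPhysics.QuantumFieldTheory.Balaban1983to89.T4HaarSU2Translate (su2Quat_mul su2Quat_one continuous_su2Quat)

namespace Summit.QuantumFields.YangMills.Theorems.FemtoTransferGap.GAxis

open ClassShift OwnAxis
open Summit.QuantumFields.YangMills.Theorems.FemtoTransferGap.TT (goodEvent mem_goodEvent_iff twist3_false)

variable {L : ℕ}

/-! ## §1 The environment on the good-field event -/

/-- **Slice drift**: with interior bonds `τ`-close, slice `k` is `kτ`-close to slice `0`, link by link. [folklore] -/
theorem norm_su2Quat_slice_sub_le {n : ℕ} {Us : Fin (n + 1) → GaugeConfig 3 L SU2} {τ : ℝ}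
    (hTi : ∀ (i : Fin n) (e : Edge 3 L), ‖su2Quat (Us i.castSucc e) - su2Quat (Us i.succ e)‖ ≤ τ) (e : Edge 3 L) :
    ∀ (k : ℕ) (hk : k < n + 1), ‖su2Quat (Us ⟨k, hk⟩ e) - su2Quat (Us 0 e)‖ ≤ k * τ
  | 0, _ => by simp
  | k + 1, hk => by
    have hk' : k < n + 1 := by omega
    have ih := norm_su2Quat_slice_sub_le hTi e k hk'
    set i : Fin n := ⟨k, by omega⟩ with hi
    have hcs : i.castSucc = ⟨k, hk'⟩ := rfl
    have hsu : i.succ = ⟨k + 1, hk⟩ := rfl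
    have hstep : ‖su2Quat (Us ⟨k + 1, hk⟩ e) - su2Quat (Us ⟨k, hk'⟩ e)‖ ≤ τ := by
      rw [← hcs, ← hsu, norm_sub_rev]; exact hTi i e
    rw [Nat.cast_succ, add_mul, one_mul]
    calc _ ≤ ‖su2Quat (Us ⟨k + 1, hk⟩ e) - su2Quat (Us ⟨k, hk'⟩ e)‖ + ‖su2Quat (Us ⟨k, hk'⟩ e) - su2Quat (Us 0 e)‖ := by
          rw [← sub_add_sub_cancel (su2Quat (Us ⟨k + 1, hk⟩ e)) (su2Quat (Us ⟨k, hk'⟩ e)) (su2Quat (Us 0 e))]; exact norm_add_le _ _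
      _ ≤ τ + k * τ := add_le_add hstep ih
      _ = k * τ + τ := add_comm _ _

/-- Every slice is `nτ`-close to slice `0`. [folklore] -/
theorem norm_su2Quat_slice_sub_le' {n : ℕ} {Us : Fin (n + 1) → GaugeConfig 3 L SU2} {τ : ℝ} (hτ : 0 ≤ τ)
    (hTi : ∀ (i : Fin n) (e : Edge 3 L), ‖su2Quat (Us i.castSucc e) - su2Quat (Us i.succ e)‖ ≤ τ) (k : Fin (n + 1)) (e : Edge 3 L) :
    ‖su2Quat (Us k e) - su2Quat (Us 0 e)‖ ≤ n * τ := by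
  have h := norm_su2Quat_slice_sub_le hTi e k.val k.isLt
  have hk : ((k.val : ℕ) : ℝ) * τ ≤ n * τ := mul_le_mul_of_nonneg_right (by exact_mod_cast Nat.lt_succ_iff.1 k.isLt) hτ
  exact h.trans hk

/-- **The seam field's gauge image of slice `0` is `(n+1)τ`-close to slice `0`** (seam bond `τ`-close to slice `n`, which drifted `nτ`). [folklore] -/
theorem norm_su2Quat_gauge_sub_le {n : ℕ} {Us : Fin (n + 1) → GaugeConfig 3 L SU2} {g : Site 3 L → SU2} {τ : ℝ} (hτ : 0 ≤ τ)
    (hTi : ∀ (i : Fin n) (e : Edge 3 L), ‖su2Quat (Us i.castSucc e) - su2Quat (Us i.succ e)‖ ≤ τ)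
    (hTs : ∀ e : Edge 3 L, ‖su2Quat (Us (Fin.last n) e) - su2Quat (gaugeTransform g (Us 0) e)‖ ≤ τ) (e : Edge 3 L) :
    ‖su2Quat (gaugeTransform g (Us 0) e) - su2Quat (Us 0 e)‖ ≤ (n + 1 : ℕ) * τ := by
  have h1 := hTs e
  have h2 := norm_su2Quat_slice_sub_le' hτ hTi (Fin.last n) e
  rw [norm_sub_rev] at h1
  calc _ ≤ ‖su2Quat (gaugeTransform g (Us 0) e) - su2Quat (Us (Fin.last n) e)‖ + ‖su2Quat (Us (Fin.last n) e) - su2Quat (Us 0 e)‖ := by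
        rw [← sub_add_sub_cancel (su2Quat (gaugeTransform g (Us 0) e)) (su2Quat (Us (Fin.last n) e)) (su2Quat (Us 0 e))]; exact norm_add_le _ _
    _ ≤ τ + n * τ := add_le_add h1 h2
    _ = (n + 1 : ℕ) * τ := by push_cast; ring

variable [NeZero L]

omit [NeZero L] in
/-- **The two holonomies through the origin almost commute**: `‖q_{P_y} q_{P_z} − q_{P_z} q_{P_y}‖ ≤ L²ε` under a plaquette bound `ε` (column ladder
around the whole torus). [cite: Luscher1983, §2] -/
theorem norm_comm_polY_polZ_le {U : GaugeConfig 3 L SU2} {ε : ℝ}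
    (hP : ∀ (y : Site 3 L) (i j : Fin 3), ‖su2Quat (plaquetteHolonomy U y i j) - 1‖ ≤ ε) :
    ‖su2Quat (lineHolonomy U 1 L 0) * su2Quat (lineHolonomy U 2 L 0) - su2Quat (lineHolonomy U 2 L 0) * su2Quat (lineHolonomy U 1 L 0)‖ ≤ L * (L * ε) := by
  have h := norm_su2Quat_column_conj_sub_le hP 1 2 L (0 : Site 3 L)
  rw [ZMod.natCast_self, Pi.single_zero, add_zero, norm_sub_rev, norm_sub_conj_eq_norm_comm] at h
  exact h

/-! ## §2 The cost exponent on the good-field event -/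

/-- ★ **The cost of the seam-axis sheet shift on the good-field event, as one explicit exponent.**  For `p = (g, U⃗) ∈ goodEvent n 0 s t`, `β ≥ 0`,
`t ≥ 0`, `χ₀, σ₁ > 0` and any `θ`:
`w₀(U⃗, g) ≤ exp(β((n+1) · #P · (D² + 2D√s) + #E · (D_g² + 2D_g t))) · w₀(gAxisShift θ χ₀ σ₁ g U⃗, g)` with
`D = |θ|(L(n+1)t/χ₀ + L²√s/σ₁ + 2σ₁) + 2L²√s|θ| + 2nt|θ|` and `D_g = 2χ₀|θ| + 4L(n+1)t|θ|`. [cite: Luscher1983, §2] [cite: SeilerLNP1982, §3] -/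
theorem seamDensity_le_exp_mul_gAxisShift {β : ℝ} (hβ : 0 ≤ β) (θ : ℝ) {χ₀ σ₁ : ℝ} (hχ : 0 < χ₀) (hσ : 0 < σ₁) {n : ℕ} {s t : ℝ} (ht : 0 ≤ t)
    {p : (Site 3 L → SU2) × (Fin (n + 1) → GaugeConfig 3 L SU2)} (hp : p ∈ goodEvent (L := L) n (fun _ => false) s t) :
    (∏ i : Fin n, transferKernel su2Rep β (p.2 i.castSucc) (p.2 i.succ)) *
        transferKernel su2Rep β (p.2 (Fin.last n)) (gaugeTransform p.1 (TT.twist3 (fun _ => false) (p.2 0))) ≤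
      Real.exp (β * ((n + 1 : ℕ) * (Fintype.card (Plaquette 3 L) *
            ((|θ| * (L * ((n + 1 : ℕ) * t) / χ₀ + L * (L * Real.sqrt s) / σ₁ + 2 * σ₁) + 2 * (L * (L * Real.sqrt s)) * |θ| + 2 * (n * t) * |θ|) ^ 2 +
              2 * (|θ| * (L * ((n + 1 : ℕ) * t) / χ₀ + L * (L * Real.sqrt s) / σ₁ + 2 * σ₁) + 2 * (L * (L * Real.sqrt s)) * |θ| + 2 * (n * t) * |θ|) * Real.sqrt s)) +
          Fintype.card (Edge 3 L) * ((2 * χ₀ * |θ| + 4 * (L * ((n + 1 : ℕ) * t)) * |θ|) ^ 2 + 2 * (2 * χ₀ * |θ| + 4 * (L * ((n + 1 : ℕ) * t)) * |θ|) * t))) *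
        ((∏ i : Fin n, transferKernel su2Rep β (gAxisShift θ χ₀ σ₁ p.1 p.2 i.castSucc) (gAxisShift θ χ₀ σ₁ p.1 p.2 i.succ)) *
          transferKernel su2Rep β (gAxisShift θ χ₀ σ₁ p.1 p.2 (Fin.last n)) (gaugeTransform p.1 (TT.twist3 (fun _ => false) (gAxisShift θ χ₀ σ₁ p.1 p.2 0)))) := by
  obtain ⟨hP, hTi, hTs⟩ := goodEvent_dictionary hp
  set g := p.1 with hg
  set Us := p.2 with hUs
  set ε := Real.sqrt s with hε
  set τg : ℝ := (n + 1 : ℕ) * t with hτg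
  -- environment
  have hG : ∀ e : Edge 3 L, ‖su2Quat (gaugeTransform g (Us 0) e) - su2Quat (Us 0 e)‖ ≤ τg := fun e => norm_su2Quat_gauge_sub_le ht hTi hTs e
  have hν : ∀ (k : Fin (n + 1)) (e : Edge 3 L), ‖su2Quat (Us k e) - su2Quat (Us 0 e)‖ ≤ n * t := fun k e => norm_su2Quat_slice_sub_le' ht hTi k e
  have hA0 : 0 ≤ L * τg := by positivity
  have hgy := norm_comm_seamField_loop_le hG 1 (0 : Site 3 L)
  have hgz := norm_comm_seamField_loop_le hG 2 (0 : Site 3 L)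
  have hyz := norm_comm_polY_polZ_le (hP 0)
  have hε0 : 0 ≤ ε := Real.sqrt_nonneg _
  have hB0 : 0 ≤ L * (L * ε) := by positivity
  obtain ⟨hMy, hMz⟩ := norm_comm_gAxisElt_loop_le θ hχ hσ hA0 hB0 g (Us 0) hgy hgz hyz
  -- the two defect bounds
  set M : ℝ := |θ| * (L * τg / χ₀ + L * (L * ε) / σ₁ + 2 * σ₁) with hM
  have hD : ∀ (k : Fin (n + 1)) (x : Site 3 L), x 0 = 0 → ∀ j : Fin 3, j ≠ 0 →
      ‖su2Quat (gAxisField θ χ₀ σ₁ g (Us 0) x) - su2Quat (Us k (x, j) * gAxisField θ χ₀ σ₁ g (Us 0) (x.shift j) * (Us k (x, j))⁻¹)‖ ≤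
        M + 2 * (L * (L * ε)) * |θ| + 2 * (n * t) * |θ| :=
    fun k x hx j hj => norm_edgeDefect_le θ hχ hσ g (hP 0) (hν k) hMy hMz hx hj
  have hDg : ∀ x : Site 3 L, x 0 = 0 →
      ‖su2Quat (gAxisField θ χ₀ σ₁ g (Us 0) x) - su2Quat (g x * gAxisField θ χ₀ σ₁ g (Us 0) x * (g x)⁻¹)‖ ≤ 2 * χ₀ * |θ| + 4 * (L * τg) * |θ| :=
    fun x hx => norm_seamDefect_le θ hχ hσ hG hx
  have h := seamDensity_le_exp_mul_siteTwist hβ (gAxisField θ χ₀ σ₁ g (Us 0)) Us g hP hTs hD hDg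
  simpa only [gAxisShift_apply, hM] using h

/-! ## §3 Measurability and measure preservation -/

omit [NeZero L] in
/-- The axis rule composed with measurable arguments is measurable. [folklore] -/
theorem measurable_gAxis_comp {α : Type*} [MeasurableSpace α] {f₁ f₂ f₃ : α → SU2} (h₁ : Measurable f₁) (h₂ : Measurable f₂) (h₃ : Measurable f₃)
    (χ₀ σ₁ : ℝ) : Measurable fun a => gAxis χ₀ σ₁ (f₁ a) (f₂ a) (f₃ a) := by
  have hc : Continuous fun W : SU2 => ‖imVec (su2Quat W)‖ := (continuous_imVec.comp continuous_su2Quat).norm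
  simp only [gAxis_def]
  refine Measurable.ite (measurableSet_le measurable_const (hc.measurable.comp h₁)) (measurable_axisVec.comp h₁) ?_
  refine Measurable.ite (measurableSet_le measurable_const (hc.measurable.comp h₂)) (measurable_axisVec.comp h₂) ?_
  exact Measurable.ite (measurableSet_le measurable_const (hc.measurable.comp h₃)) (measurable_axisVec.comp h₃) measurable_const

omit [NeZero L] in
/-- The comb transport is measurable in the configuration. [folklore] -/
theorem measurable_sheetTransport (x : Site 3 L) : Measurable fun U : GaugeConfig 3 L SU2 => sheetTransport U x := by
  simp only [sheetTransport_def]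
  exact (measurable_lineHolonomy 2 _ _).mul (measurable_lineHolonomy 1 _ _)

omit [NeZero L] in
/-- The reference rotation composed with measurable arguments is measurable. [folklore] -/
theorem measurable_gAxisElt_comp {α : Type*} [MeasurableSpace α] {fg : α → (Site 3 L → SU2)} {fU : α → GaugeConfig 3 L SU2}
    (hg : Measurable fg) (hU : Measurable fU) (θ χ₀ σ₁ : ℝ) : Measurable fun a => gAxisElt θ χ₀ σ₁ (fg a) (fU a) := by
  have h1 : Measurable fun a => fg a 0 := (measurable_pi_apply 0).comp hg
  have h2 : Measurable fun a => lineHolonomy (fU a) 1 L 0 := (measurable_lineHolonomy 1 L 0).comp hU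
  have h3 : Measurable fun a => lineHolonomy (fU a) 2 L 0 := (measurable_lineHolonomy 2 L 0).comp hU
  have hax := measurable_gAxis_comp h1 h2 h3 χ₀ σ₁
  simp only [gAxisElt_def]
  exact measurable_expPoint.comp (hax.const_smul θ)

omit [NeZero L] in
/-- ★ **Joint measurability of the transported field** composed with measurable arguments `(g, U)`. [folklore] -/
theorem measurable_gAxisField_comp {α : Type*} [MeasurableSpace α] {fg : α → (Site 3 L → SU2)} {fU : α → GaugeConfig 3 L SU2}
    (hg : Measurable fg) (hU : Measurable fU) (θ χ₀ σ₁ : ℝ) : Measurable fun a => gAxisField θ χ₀ σ₁ (fg a) (fU a) := by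
  refine measurable_pi_lambda _ fun x => ?_
  have hW : Measurable fun a => sheetTransport (fU a) x := (measurable_sheetTransport x).comp hU
  have hE := measurable_gAxisElt_comp hg hU θ χ₀ σ₁
  simp only [gAxisField_apply]
  exact (hW.inv.mul hE).mul hW

omit [NeZero L] in
/-- Measurability of `U ↦ gAxisField θ χ₀ σ₁ g U` for a fixed seam field. [folklore] -/
theorem measurable_gAxisField (θ χ₀ σ₁ : ℝ) (g : Site 3 L → SU2) : Measurable fun U : GaugeConfig 3 L SU2 => gAxisField θ χ₀ σ₁ g U :=
  measurable_gAxisField_comp measurable_const measurable_id θ χ₀ σ₁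

omit [NeZero L] in
/-- ★ **The transported field does not read the sheet links**: it depends only on the `y`- and `z`-links (and the seam field). [folklore] -/
theorem gAxisField_indep (θ χ₀ σ₁ : ℝ) (g : Site 3 L → SU2) (U V : GaugeConfig 3 L SU2)
    (hUV : ∀ e : Edge 3 L, ¬ (e.2 = 0 ∧ e.1 0 = 0) → U e = V e) : gAxisField θ χ₀ σ₁ g U = gAxisField θ χ₀ σ₁ g V := by
  have hline : ∀ {k : Fin 3}, k ≠ 0 → ∀ (m : ℕ) (y : Site 3 L), lineHolonomy U k m y = lineHolonomy V k m y :=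
    fun hk m y => WilsonLoopRP.lineHolonomy_congr _ m y fun s _ => hUV _ fun h => hk h.1
  have hW : ∀ x : Site 3 L, sheetTransport U x = sheetTransport V x := fun x => by
    rw [sheetTransport_def, sheetTransport_def, hline (by decide), hline (by decide)]
  funext x
  rw [gAxisField_apply, gAxisField_apply, gAxisElt_def, gAxisElt_def, hW, hline (k := 1) (by decide), hline (k := 2) (by decide)]

/-- ★ **Measure preservation**: for every seam field `g`, `U⃗ ↦ gAxisShift θ χ₀ σ₁ g U⃗` preserves `⊗_t configMeasure` (a skew product of left
translations read from the non-sheet links of slice `0`). [cite: Luscher1983, §2] -/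
theorem measurePreserving_gAxisShift (θ χ₀ σ₁ : ℝ) (g : Site 3 L → SU2) (n : ℕ) :
    MeasurePreserving (gAxisShift (n := n) θ χ₀ σ₁ g) (Measure.pi fun _ : Fin (n + 1) => configMeasure SU2 L)
      (Measure.pi fun _ : Fin (n + 1) => configMeasure SU2 L) := by
  haveI : SecondCountableTopology SU2 := secondCountableTopology_su2
  have h := measurePreserving_chain_siteTwist_of_indep (G := SU2) (L := L) (n := n) 0 (measurable_gAxisField θ χ₀ σ₁ g) (gAxisField_indep θ χ₀ σ₁ g)
  have e : (gAxisShift (n := n) θ χ₀ σ₁ g) = fun (Us : Fin (n + 1) → GaugeConfig 3 L SU2) (t : Fin (n + 1)) => siteTwist 0 (gAxisField θ χ₀ σ₁ g (Us 0)) (Us t) := by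
    funext Us t; rfl
  rw [e]; exact h

omit [NeZero L] in
/-- A sheet translate by a measurable field of a measurable configuration is measurable. [folklore] -/
theorem measurable_siteTwist_comp {α : Type*} [MeasurableSpace α] {F : α → (Site 3 L → SU2)} {G : α → GaugeConfig 3 L SU2}
    (hF : Measurable F) (hG : Measurable G) : Measurable fun a => siteTwist 0 (F a) (G a) :=
  (measurable_siteTwist_uncurry (G := SU2) (L := L) 0).comp (hF.prodMk hG)

omit [NeZero L] in
/-- **Joint measurability** of `(g, U⃗) ↦ gAxisShift θ χ₀ σ₁ g U⃗`. [folklore] -/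
theorem measurable_gAxisShift_uncurry (θ χ₀ σ₁ : ℝ) (n : ℕ) :
    Measurable (uncurry (gAxisShift (L := L) (n := n) θ χ₀ σ₁)) := by
  have hF : Measurable fun q : (Site 3 L → SU2) × (Fin (n + 1) → GaugeConfig 3 L SU2) => gAxisField θ χ₀ σ₁ q.1 (q.2 0) :=
    measurable_gAxisField_comp measurable_fst ((measurable_pi_apply 0).comp measurable_snd) θ χ₀ σ₁
  have e : uncurry (gAxisShift (L := L) (n := n) θ χ₀ σ₁) =
      fun q : (Site 3 L → SU2) × (Fin (n + 1) → GaugeConfig 3 L SU2) => fun t : Fin (n + 1) => siteTwist 0 (gAxisField θ χ₀ σ₁ q.1 (q.2 0)) (q.2 t) := by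
    funext q t; rfl
  rw [e]
  refine measurable_pi_lambda _ fun t => ?_
  exact measurable_siteTwist_comp hF ((measurable_pi_apply t).comp measurable_snd)

end Summit.QuantumFields.YangMills.Theorems.FemtoTransferGap.GAxis

end
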